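import Literature.NumberTheory.EllipticCurves.FormalGroupNilIdealPoints
import Literature.NumberTheory.EllipticCurves.FormalGroupChordFormulaUniversalProofs
import HarnessLib

/-!
# The formal group computes `E₁(K)`, II: two-variable evaluation and the chord case
# `P(u) + P(v) = P(F_W(u, v))` for `x(P(u)) ≠ x(P(v))` (Silverman AEC VII.2.2)

Topic `Literature/NumberTheory/EllipticCurves`; sequel of `FormalGroupNilIdealPoints` (notation from there: `K` a complete
ultrametric field, `𝔪_K = ballNilIdeal K`, `W` a Weierstrass equation over a discrete coefficient ring `A` acting on `𝒪_K`,
`E = curveOver K W`, `P(t) = ptOfZ K W t`, `X(t) = evX W t`). Port to the `LubinTate` evaluation layer of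
`Summits/…/Rank1Residual/Additive/FormalGroupBallPointsAdd` (same proofs), using the RING-GENERAL chord identities
`formalXMulSq_formalGroupLaw_chord'/chordY'` (`FormalGroupChordFormulaUniversalProofs`):

* §1 `evalAt₂ u v` (evaluation of `A⟦z₁, z₂⟧` at a pair of points of `𝔪_K`), its dictionary (`evalAt₂_X0/X1/C`,
  `evalAt₂_subst_X0/X1`, `evalAt₂_subst_formalGroupLaw`), and **`evF W u v = F_W(u, v) ∈ 𝔪_K`** — by definition the
  sum `u + v` in the group `Ŵ(𝔪_K) = W.Pt (ballNilIdeal K)` of `WeierstrassFormalGroupPoints` (`evF_eq_add`);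
  `F(t, 0) = t`, `F(0, t) = t`, `F(t, i t) = 0` at points.
* §2 the chord identities at `(u, v)` (`chordX_at`, `chordY_at`) and **`ptOfZ_add_of_x_ne`:
  `P(u) + P(v) = P(F_W(u, v))` when `x(P(u)) ≠ x(P(v))`**.

The sequel (`…GroupIso`) does the tangent case and assembles the group isomorphism `Ŵ(𝔪_K) ≃+ E₁(K)`.
BSD / K★ (`Cruxes/StarredOptimalManinUnitFiveSeven/Lines/kato-lever-hDR-sector-iii-periods.md` §5 (M1)): infrastructure;
nothing about elliptic curves over number fields is proved here.

## References
* J. H. Silverman, *The Arithmetic of Elliptic Curves* (2009), III.2.3, IV.1–IV.2, Prop. VII.2.2. [SilvermanAEC2009]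
-/

noncomputable section

open scoped Classical NNReal
open PowerSeries

namespace Literature.NumberTheory.EllipticCurves

open Literature.NumberTheory.GaloisRepresentations.LubinTate
open Literature.NumberTheory.EllipticCurves.FormalGroupChart _root_.WeierstrassCurve

/-! ## §1 Two-variable evaluation and `F_W(u, v)` -/

section Eval₂

variable {A : Type*} [CommRing A] [UniformSpace A] [DiscreteUniformity A]
  {K : Type*} [NontriviallyNormedField K] [IsUltrametricDist K] [CompleteSpace K]
  [Algebra A (unitBall K)] [ContinuousSMul A (unitBall K)]

/-- **Evaluation of `A⟦z₁, z₂⟧` at a pair `(u, v)` of points of `𝔪_K`** (Mathlib `MvPowerSeries.aeval`).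
[cite: CasselsFrohlichANT1967, Ch. VI §3.2] -/
def evalAt₂ (u v : (ballNilIdeal K).toIdeal) : MvPowerSeries (Fin 2) A →ₐ[A] unitBall K :=
  MvPowerSeries.aeval ((ballNilIdeal K).hasEval ![u, v])

/-- `evalAt₂ u v z₁ = u`. [cite: CasselsFrohlichANT1967, Ch. VI §3.2] -/
@[simp] theorem evalAt₂_X0 (u v : (ballNilIdeal K).toIdeal) :
    evalAt₂ u v (MvPowerSeries.X 0 : MvPowerSeries (Fin 2) A) = (u : unitBall K) :=
  aeval_X' _ 0

/-- `evalAt₂ u v z₂ = v`. [cite: CasselsFrohlichANT1967, Ch. VI §3.2] -/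
@[simp] theorem evalAt₂_X1 (u v : (ballNilIdeal K).toIdeal) :
    evalAt₂ u v (MvPowerSeries.X 1 : MvPowerSeries (Fin 2) A) = (v : unitBall K) :=
  aeval_X' _ 1

/-- `evalAt₂ u v (C a) = a`. [cite: CasselsFrohlichANT1967, Ch. VI §3.2] -/
@[simp] theorem evalAt₂_C (u v : (ballNilIdeal K).toIdeal) (a : A) :
    evalAt₂ u v (MvPowerSeries.C a : MvPowerSeries (Fin 2) A) = algebraMap A (unitBall K) a := by
  rw [evalAt₂, MvPowerSeries.coe_aeval, MvPowerSeries.eval₂_C]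

/-- Dictionary: `evalAt₂ u v (f(z₁)) = f(u)`. [cite: CasselsFrohlichANT1967, Ch. VI §3.2] -/
theorem evalAt₂_subst_X0 (u v : (ballNilIdeal K).toIdeal) (f : PowerSeries A) :
    evalAt₂ u v (f.subst (MvPowerSeries.X 0 : MvPowerSeries (Fin 2) A)) = evalAt (ballNilIdeal K) u f := by
  change MvPowerSeries.aeval _ (MvPowerSeries.subst (fun _ : Unit => (MvPowerSeries.X 0 : MvPowerSeries (Fin 2) A)) f) =
    MvPowerSeries.aeval ((ballNilIdeal K).hasEval fun _ : Unit => u) f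
  exact aeval_subst (MvPowerSeries.hasSubst_of_constantCoeff_zero fun _ => MvPowerSeries.constantCoeff_X 0) _ f _
    (fun _ => aeval_X' _ 0)

/-- Dictionary: `evalAt₂ u v (f(z₂)) = f(v)`. [cite: CasselsFrohlichANT1967, Ch. VI §3.2] -/
theorem evalAt₂_subst_X1 (u v : (ballNilIdeal K).toIdeal) (f : PowerSeries A) :
    evalAt₂ u v (f.subst (MvPowerSeries.X 1 : MvPowerSeries (Fin 2) A)) = evalAt (ballNilIdeal K) v f := by
  change MvPowerSeries.aeval _ (MvPowerSeries.subst (fun _ : Unit => (MvPowerSeries.X 1 : MvPowerSeries (Fin 2) A)) f) =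
    MvPowerSeries.aeval ((ballNilIdeal K).hasEval fun _ : Unit => v) f
  exact aeval_subst (MvPowerSeries.hasSubst_of_constantCoeff_zero fun _ => MvPowerSeries.constantCoeff_X 1) _ f _
    (fun _ => aeval_X' _ 1)

variable (W : WeierstrassCurve A)

/-- **`F_W(u, v) ∈ 𝔪_K`**: the formal group law evaluated at a pair of points (the tree's `LubinTate.addPt` for the
Mathlib formal group `W.toFormalGroup`). [cite: SilvermanAEC2009, Prop. VII.2.2] -/
def evF (u v : (ballNilIdeal K).toIdeal) : (ballNilIdeal K).toIdeal := addPt (ballNilIdeal K) W.toFormalGroup u v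

/-- `F_W(u, v)` IS the sum `u + v` in the group `Ŵ(𝔪_K) = W.Pt (ballNilIdeal K)`. [cite: CasselsFrohlichANT1967, Ch. VI §3.2] -/
theorem evF_eq_add (u v : (ballNilIdeal K).toIdeal) :
    evF W u v = ((⟨u⟩ : W.Pt (ballNilIdeal K)) + ⟨v⟩).val := rfl

/-- Unfolding `evF` as an evaluation of `W.formalGroupLaw`. [cite: SilvermanAEC2009, Prop. VII.2.2] -/
theorem coe_evF (u v : (ballNilIdeal K).toIdeal) :
    ((evF W u v : (ballNilIdeal K).toIdeal) : unitBall K) = evalAt₂ u v W.formalGroupLaw := rfl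

variable {W}

/-- Dictionary: `evalAt₂ u v (f(F_W)) = f(F_W(u, v))`. [cite: CasselsFrohlichANT1967, Ch. VI §3.2] -/
theorem evalAt₂_subst_formalGroupLaw (u v : (ballNilIdeal K).toIdeal) (f : PowerSeries A) :
    evalAt₂ u v (f.subst W.formalGroupLaw) = evalAt (ballNilIdeal K) (evF W u v) f := by
  change MvPowerSeries.aeval _ (MvPowerSeries.subst (fun _ : Unit => W.formalGroupLaw) f) =
    MvPowerSeries.aeval ((ballNilIdeal K).hasEval fun _ : Unit => evF W u v) f
  exact aeval_subst (MvPowerSeries.hasSubst_of_constantCoeff_zero fun _ => W.constantCoeff_formalGroupLaw) _ f _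
    (fun _ => rfl)

/-- **`F(t, 0) = t`** at points. [cite: SilvermanAEC2009, IV.2] -/
theorem evF_zero_right (t : (ballNilIdeal K).toIdeal) : evF W t 0 = t := WeierstrassCurve.Pt.addPt_zero W t

/-- **`F(0, t) = t`** at points. [cite: SilvermanAEC2009, IV.2] -/
theorem evF_zero_left (t : (ballNilIdeal K).toIdeal) : evF W 0 t = t := by
  rw [evF, addPt_comm]; exact WeierstrassCurve.Pt.addPt_zero W t

/-- **`F(t, i_W(t)) = 0`** at points. [cite: SilvermanAEC2009, IV.2] -/
theorem evF_formalNeg (t : (ballNilIdeal K).toIdeal) :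
    evF W t (evalPt₁ (ballNilIdeal K) W.formalNeg W.constantCoeff_formalNeg t) = 0 :=
  WeierstrassCurve.Pt.addPt_formalNeg W t

/-- `F(u, v) = F(v, u)` at points. [cite: SilvermanAEC2009, IV.2] -/
theorem evF_comm (u v : (ballNilIdeal K).toIdeal) : evF W u v = evF W v u := addPt_comm _ _ u v

end Eval₂

/-! ## §2 The chord case -/

section Chord

variable {A : Type*} [CommRing A] [UniformSpace A] [DiscreteUniformity A]
  {K : Type*} [NontriviallyNormedField K] [IsUltrametricDist K] [CompleteSpace K]
  [Algebra A (unitBall K)] [ContinuousSMul A (unitBall K)] {W : WeierstrassCurve A}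

/-- **The chord identity for `x`, at `(u, v)`** (`formalXMulSq_formalGroupLaw_chord'` evaluated; `X₀ = X(u)`,
`X₁ = X(v)`, `F = F_W(u,v)`, `X_F = X(F)`). [cite: SilvermanAEC2009, IV.1] -/
theorem chordX_at (u v : (ballNilIdeal K).toIdeal) :
    evX W (evF W u v) * (evX W u * ((v : unitBall K) : K) ^ 2 - evX W v * ((u : unitBall K) : K) ^ 2) ^ 2 *
        ((u : unitBall K) : K) ^ 2 * ((v : unitBall K) : K) ^ 2 =
      (((evF W u v : (ballNilIdeal K).toIdeal) : unitBall K) : K) ^ 2 *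
        ((evX W v * ((u : unitBall K) : K) ^ 3 - evX W u * ((v : unitBall K) : K) ^ 3) ^ 2 +
            cK K W.a₁ * (evX W v * ((u : unitBall K) : K) ^ 3 - evX W u * ((v : unitBall K) : K) ^ 3) *
              (evX W u * ((v : unitBall K) : K) ^ 2 - evX W v * ((u : unitBall K) : K) ^ 2) *
              ((u : unitBall K) : K) * ((v : unitBall K) : K) -
          (cK K W.a₂ * ((u : unitBall K) : K) ^ 2 * ((v : unitBall K) : K) ^ 2 + evX W u * ((v : unitBall K) : K) ^ 2 +
              evX W v * ((u : unitBall K) : K) ^ 2) *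
            (evX W u * ((v : unitBall K) : K) ^ 2 - evX W v * ((u : unitBall K) : K) ^ 2) ^ 2) := by
  have h := congrArg (evalAt₂ u v) W.formalXMulSq_formalGroupLaw_chord'
  simp only [map_mul, map_pow, map_add, map_sub, evalAt₂_X0, evalAt₂_X1, evalAt₂_C] at h
  rw [evalAt₂_subst_X0 u v W.formalXMulSq, evalAt₂_subst_X1 u v W.formalXMulSq,
    evalAt₂_subst_formalGroupLaw u v W.formalXMulSq] at h
  have h' := congrArg Subtype.val h
  simp only [Subring.coe_mul, SubmonoidClass.coe_pow, Subring.coe_add, AddSubgroupClass.coe_sub] at h'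
  exact h'

/-- **The chord identity for `y`, at `(u, v)`** (`formalXMulSq_formalGroupLaw_chordY'` evaluated).
[cite: SilvermanAEC2009, IV.1] -/
theorem chordY_at (u v : (ballNilIdeal K).toIdeal) :
    (-evX W (evF W u v) + cK K W.a₁ * evX W (evF W u v) * (((evF W u v : (ballNilIdeal K).toIdeal) : unitBall K) : K) +
          cK K W.a₃ * (((evF W u v : (ballNilIdeal K).toIdeal) : unitBall K) : K) ^ 3) *
        (evX W u * ((v : unitBall K) : K) ^ 2 - evX W v * ((u : unitBall K) : K) ^ 2) * ((u : unitBall K) : K) ^ 3 *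
        ((v : unitBall K) : K) =
      -((evX W v * ((u : unitBall K) : K) ^ 3 - evX W u * ((v : unitBall K) : K) ^ 3) *
          (evX W (evF W u v) * ((u : unitBall K) : K) ^ 2 -
            evX W u * (((evF W u v : (ballNilIdeal K).toIdeal) : unitBall K) : K) ^ 2) *
          (((evF W u v : (ballNilIdeal K).toIdeal) : unitBall K) : K)) +
        evX W u * (evX W u * ((v : unitBall K) : K) ^ 2 - evX W v * ((u : unitBall K) : K) ^ 2) *
          (((evF W u v : (ballNilIdeal K).toIdeal) : unitBall K) : K) ^ 3 * ((v : unitBall K) : K) := by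
  have h := congrArg (evalAt₂ u v) W.formalXMulSq_formalGroupLaw_chordY'
  simp only [map_mul, map_pow, map_add, map_sub, map_neg, evalAt₂_X0, evalAt₂_X1, evalAt₂_C] at h
  rw [evalAt₂_subst_X0 u v W.formalXMulSq, evalAt₂_subst_X1 u v W.formalXMulSq,
    evalAt₂_subst_formalGroupLaw u v W.formalXMulSq] at h
  have h' := congrArg Subtype.val h
  simp only [Subring.coe_mul, SubmonoidClass.coe_pow, Subring.coe_add, AddSubgroupClass.coe_sub,
    NegMemClass.coe_neg] at h'
  exact h'

variable [hE : (curveOver K W).IsElliptic]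

omit hE in
/-- `F_W(u, v) ≠ 0` in the chord configuration (`u, v ≠ 0`, `x(P(u)) ≠ x(P(v))`). [cite: SilvermanAEC2009, Prop. VII.2.2] -/
theorem evF_ne_zero_of_x_ne {u v : (ballNilIdeal K).toIdeal} (hu0 : ((u : unitBall K) : K) ≠ 0)
    (hv0 : ((v : unitBall K) : K) ≠ 0)
    (hx : evX W u / ((u : unitBall K) : K) ^ 2 ≠ evX W v / ((v : unitBall K) : K) ^ 2) :
    (((evF W u v : (ballNilIdeal K).toIdeal) : unitBall K) : K) ≠ 0 := by
  have keyX := chordX_at (W := W) u v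
  intro hF
  have hxs : evX W u * ((v : unitBall K) : K) ^ 2 - evX W v * ((u : unitBall K) : K) ^ 2 ≠ 0 := by
    intro h0
    apply hx
    rw [div_eq_div_iff (pow_ne_zero 2 hu0) (pow_ne_zero 2 hv0)]
    linear_combination h0
  have hXF : evX W (evF W u v) = 1 := by
    have h1 := norm_evX_sub_one_le (W := W) (evF W u v)
    rw [hF, norm_zero] at h1
    exact sub_eq_zero.mp (norm_le_zero_iff.mp h1)
  rw [hF, hXF] at keyX
  have : (evX W u * ((v : unitBall K) : K) ^ 2 - evX W v * ((u : unitBall K) : K) ^ 2) ^ 2 *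
      ((u : unitBall K) : K) ^ 2 * ((v : unitBall K) : K) ^ 2 = 0 := by
    linear_combination keyX
  simp only [mul_eq_zero, pow_eq_zero_iff, ne_eq, OfNat.ofNat_ne_zero, not_false_eq_true] at this
  rcases this with (h | h) | h
  · exact hxs h
  · exact hu0 h
  · exact hv0 h

/-- **`P(u) + P(v) = P(F_W(u, v))` when `x(P(u)) ≠ x(P(v))`** (the chord case; `u, v ≠ 0`): Mathlib's chord
`(addX, addY)` against the chord identities at `(u, v)`, via the field algebra `chart_chordX/Y`.
[cite: SilvermanAEC2009, Prop. VII.2.2] -/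
theorem ptOfZ_add_of_x_ne {u v : (ballNilIdeal K).toIdeal} (hu0 : ((u : unitBall K) : K) ≠ 0)
    (hv0 : ((v : unitBall K) : K) ≠ 0)
    (hx : evX W u / ((u : unitBall K) : K) ^ 2 ≠ evX W v / ((v : unitBall K) : K) ^ 2) :
    ptOfZ K W u + ptOfZ K W v = ptOfZ K W (evF W u v) := by
  have keyX := chordX_at (W := W) u v
  have keyY := chordY_at (W := W) u v
  have hF0 := evF_ne_zero_of_x_ne (W := W) hu0 hv0 hx
  set F : K := (((evF W u v : (ballNilIdeal K).toIdeal) : unitBall K) : K) with hFdef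
  set X₀ : K := evX W u
  set X₁ : K := evX W v
  set XF : K := evX W (evF W u v)
  rw [ptOfZ_of_ne_zero hu0, ptOfZ_of_ne_zero hv0, ptOfZ_of_ne_zero hF0, Affine.Point.add_of_X_ne hx]
  simp only [Affine.Point.some.injEq]
  have hcX := chart_chordX hu0 hv0 hF0 keyX
  have hcY := chart_chordY hu0 hv0 hF0 keyY
  have haddX := chord_addX_mul (curveOver K W) (-X₀ / ((u : unitBall K) : K) ^ 3) (-X₁ / ((v : unitBall K) : K) ^ 3) hx
  have haddY := chord_addY_mul (curveOver K W) (-X₀ / ((u : unitBall K) : K) ^ 3) (-X₁ / ((v : unitBall K) : K) ^ 3) hx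
  simp only [(curveOver_a (K := K) (W := W)).1, (curveOver_a (K := K) (W := W)).2.1,
    (curveOver_a (K := K) (W := W)).2.2.1] at haddX haddY ⊢
  have hD : X₀ / ((u : unitBall K) : K) ^ 2 - X₁ / ((v : unitBall K) : K) ^ 2 ≠ 0 := sub_ne_zero.mpr hx
  have hX3 := mul_right_cancel₀ (pow_ne_zero 2 hD) (haddX.trans hcX.symm)
  refine ⟨hX3, ?_⟩
  rw [hX3] at haddY
  have hY3 := mul_right_cancel₀ hD (haddY.trans hcY.symm)
  linear_combination hY3

end Chord

end Literature.NumberTheory.EllipticCurves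

end
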